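import Literature.IUT.HodgeTheaters.ThetaNFHodgeTheatersHomNonVacuity
import HarnessLib

/-!
# [IUTchI] Cor. 5.6 (ii) (repaired form): the predicate `S5Local.Cor56ii_HTR` is a SCHEMA — universal-closure
# certificate (proof-only)

S. Mochizuki, *Inter-universal Teichmüller theory I*, kurims manuscript (May 2020), §5, Corollary 5.6 (ii) pp. 153–154
("the natural functorially induced map from the set of isomorphisms between two … ΘNF-Hodge theaters to the set of
isomorphisms between the respective associated … `𝒟`-ΘNF-Hodge theaters is bijective") [claim: Mochizuki2012, status:
disputed] (IUTchI §5 Cor 5.6 (ii), kurims pp.153-154).  abc-iut cell, FACT-LIST row **F-2046** of layer L5 (seat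
abc-iut-w6-d089 gen 5, row «KL5-CLOSURE-CERTS-4»).  PROOF-ONLY companion of abc-iut-L5-t3's `ThetaNFHodgeTheaters.lean`
(no `def`, no `instance`, nothing re-typed); it consumes `ThetaNFHodgeTheatersHomNonVacuity.lean` /
`ThetaNFHodgeTheatersProofs.lean` (generic inhabitants) BY NAME.

The row was «LABEL-OPEN, conditional/instance events only»: conditional closers `cor56ii_HTR_of_NF`,
`cor56ii_HTR_of_baseGIso_bijective` (the Cor. 5.3 (i) rigidity input "`S.baseGIso` bijective") exist, a universal-closure
decision did not.  `Cor56ii_HTR H H'` is a statement about an ARBITRARY stub `S : S5Local 𝔡`: with the morphisms as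
recorded, an isomorphism of ΘNF-Hodge theaters carries as its one free datum the poly-isomorphism `¹ℱ^⊚ ⥲ ²ℱ^⊚` LIFTING
the `Aut_ε`-orbit of base isomorphisms (`NFBridge.Hom.globIso`, `under_orbit`).  Whenever `S.baseGIso` identifies two
distinct isomorphisms `e ≠ e'` of `ℱ^⊚`-isomorphs lying over a member of that orbit, the full preimage of the orbit and
the preimage with `e` removed are two different lifts of the SAME isomorphism of associated `𝒟`-ΘNF-Hodge theaters — the
"natural functorially induced map" is not injective.  Such a stub exists over the base model `trivialModel`: the tree's
KIT-RULE witness `toyS5Local` with its ambient category of `ℱ^⊚`-isomorphs replaced by the one-object groupoid on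
`𝔽_5^⋇ × ℤ/2` and base functor the first projection (surjective on isomorphisms, two-to-one); ΘNF-Hodge theaters and
their morphisms over it exist by the generic `nonempty_thetaNFHodgeTheater` /
`ThetaNFHodgeTheater.Hom.nonempty_of_baseGIso_surjective`.

* `not_cor56ii_HTR_of_two_lifts` — WHICH DEGENERATION KILLS THE CLAUSE (any stub): a morphism `φ : H → H'` plus two
  distinct `e ≠ e'` with `baseGIso e = baseGIso e' ∈` the orbit of `φ` ⇒ `¬ Cor56ii_HTR H H'`;
* `exists_not_cor56ii_HTR` — the stub above; `not_forall_cor56ii_HTR` — **F-2046 is a schema**: the universal closure is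
  FALSE; the content is `cor56ii_HTR_of_baseGIso_bijective` (injectivity of `baseGIso` is exactly what fails here).

HONEST FRAMING: the witness is OUR stub with a deliberately non-faithful base functor on `ℱ^⊚`-isomorphs; print's
`ℱ^⊚` is category-theoretically rigid over its base (Cor. 5.3 (i)), which is the conditional closer's hypothesis.  Nothing
here bears on [IUTchIII] Cor. 3.12 or takes a side; typed ≠ proved; refuted-as-typed ≠ refuted-in-print.
-/

namespace Literature.IUT.HodgeTheaters

namespace BaseThetaDatum

open CategoryTheory TrivialModel

universe u

namespace S5Local

variable {𝔡 : BaseThetaDatum.{u}} {S : S5Local 𝔡}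

/-- **IUTchI:Cor5.6(ii)** (repaired form, kurims pp.153-154) fails for `(H, H')` over any stub admitting a morphism
`φ : H → H'` and two DISTINCT isomorphisms `e ≠ e'` of `ℱ^⊚`-isomorphs with the same base isomorphism, lying over the
`Aut_ε`-orbit of `φ`: the full preimage of the orbit and the preimage minus `e` both lift `φ`'s isomorphism of associated
`𝒟`-ΘNF-Hodge theaters. [claim: Mochizuki2012, status: disputed] (IUTchI §5 Cor 5.6 (ii), kurims pp.153-154) -/
theorem not_cor56ii_HTR_of_two_lifts {H H' : ThetaNFHodgeTheater S} (φ : ThetaNFHodgeTheater.Hom H H')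
    (e e' : H.toNFBridge.globF ≅ H'.toNFBridge.globF) (hne : e ≠ e') (hee' : S.baseGIso e = S.baseGIso e')
    (he : S.baseGIso e ∈ φ.nf.under.orbit) : ¬ Cor56ii_HTR H H' := by
  intro h
  have horb : ∀ b ∈ φ.nf.under.orbit, ∃ x ∈ φ.nf.globIso, S.baseGIso x = b := fun b hb => by
    have hb' : b ∈ {b | ∃ x ∈ φ.nf.globIso, S.baseGIso x = b} := by
      rw [← φ.nf.under_orbit]
      exact hb
    exact hb'
  -- lift 1: the full preimage of the orbit
  have hP : φ.nf.under.orbit =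
      {b | ∃ x ∈ ({x | S.baseGIso x ∈ φ.nf.under.orbit} : PolyIso H.toNFBridge.globF H'.toNFBridge.globF),
        S.baseGIso x = b} := by
    ext b
    constructor
    · intro hb
      obtain ⟨x, -, hxb⟩ := horb b hb
      exact ⟨x, show S.baseGIso x ∈ φ.nf.under.orbit from hxb ▸ hb, hxb⟩
    · rintro ⟨x, hx, rfl⟩
      exact hx
  -- lift 2: the preimage with `e` removed (still onto the orbit, thanks to `e'`)
  have hP₀ : φ.nf.under.orbit =
      {b | ∃ x ∈ ({x | S.baseGIso x ∈ φ.nf.under.orbit ∧ x ≠ e} : PolyIso H.toNFBridge.globF H'.toNFBridge.globF),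
        S.baseGIso x = b} := by
    ext b
    constructor
    · intro hb
      obtain ⟨x, -, hxb⟩ := horb b hb
      by_cases hxe : x = e
      · subst hxe
        exact ⟨e', ⟨hee' ▸ hxb ▸ hb, fun h' => hne h'.symm⟩, hee'.symm.trans hxb⟩
      · exact ⟨x, ⟨hxb ▸ hb, hxe⟩, hxb⟩
    · rintro ⟨x, ⟨hx, -⟩, rfl⟩
      exact hx
  have heq := @h.1 ⟨⟨_, φ.nf.under, hP⟩, φ.theta, φ.compat⟩ ⟨⟨_, φ.nf.under, hP₀⟩, φ.theta, φ.compat⟩ rfl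
  have hglob := congrArg (fun ψ : ThetaNFHodgeTheater.Hom H H' => e ∈ ψ.nf.globIso) heq
  simp only [eq_iff_iff] at hglob
  exact (hglob.mp he).2 rfl

end S5Local

/-- **A stub over the base model at which Cor. 5.6 (ii) as typed FAILS**: the KIT-RULE witness `toyS5Local` with the
ambient category of `ℱ^⊚`-isomorphs replaced by the one-object groupoid on `𝔽_5^⋇ × ℤ/2` and base functor the first
projection (onto `Base = SingleObj 𝔽_5^⋇`, two-to-one on isomorphisms); a ΘNF-Hodge theater `H` over it and a morphism
`H → H` exist generically (`nonempty_thetaNFHodgeTheater`, `Hom.nonempty_of_baseGIso_surjective`), and the two lifts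
`(δ, 1) ≠ (δ, −1)` of a member `δ` of its `Aut_ε`-orbit feed `not_cor56ii_HTR_of_two_lifts`.
[claim: Mochizuki2012, status: disputed] (IUTchI §5 Cor 5.6 (ii), kurims pp.153-154) -/
theorem exists_not_cor56ii_HTR :
    ∃ (S : S5Local trivialModel) (H : S5Local.ThetaNFHodgeTheater S), ¬ S5Local.Cor56ii_HTR H H := by
  let G : Type := FlStar 5 × Multiplicative (ZMod 2)
  let F : SingleObj G ⥤ GlobAmb := SingleObj.mapHom G (FlStar 5) (MonoidHom.fst (FlStar 5) (Multiplicative (ZMod 2)))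
  let S : S5Local trivialModel :=
    { toyS5Local with
      FAmbG := SingleObj G
      catFAmbG := inferInstance
      FG := SingleObj.star G
      nonempty_isoFG := fun _ _ => ⟨Iso.refl _⟩
      baseG := fun Y => F.obj Y
      baseGIso := fun b => F.mapIso b
      baseGIso_refl := fun Y => F.mapIso_refl Y
      baseGIso_trans := fun b b' => F.mapIso_trans b b'
      DashArrow := fun _ _ => PUnit
      dashModel := PUnit.unit
      restrictAt := fun _ _ v => toyS5Local.F v
      restrictionOf := fun _ _ _ => PUnit.unit }
  -- the two-to-one lifting of base isomorphisms: `(b, z)` lies over `b` for each `z ∈ ℤ/2`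
  let lift : ∀ {Y Y' : SingleObj G} (b : F.obj Y ≅ F.obj Y') (z : Multiplicative (ZMod 2)), (Y ≅ Y') :=
    fun b z =>
      { hom := (b.hom, z)
        inv := (b.inv, z⁻¹)
        hom_inv_id := Prod.ext b.hom_inv_id (inv_mul_cancel z)
        inv_hom_id := Prod.ext b.inv_hom_id (mul_inv_cancel z) }
  have hlift : ∀ {Y Y' : SingleObj G} (b : F.obj Y ≅ F.obj Y') (z : Multiplicative (ZMod 2)),
      F.mapIso (lift b z) = b := fun b z => Iso.ext rfl
  have hsurj : ∀ Y Y' : S.FAmbG,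
      Function.Surjective (S.baseGIso : (Y ≅ Y') → (S.baseG Y ≅ S.baseG Y')) :=
    fun Y Y' b => ⟨lift b 1, hlift b 1⟩
  obtain ⟨H⟩ := S5Local.nonempty_thetaNFHodgeTheater S
  obtain ⟨φ⟩ := S5Local.ThetaNFHodgeTheater.Hom.nonempty_of_baseGIso_surjective H H (hsurj _ _)
  obtain ⟨δ, hδ⟩ := φ.nf.under.isOrbit
  have hmem : δ ∈ φ.nf.under.orbit := by
    rw [hδ]
    exact ⟨Iso.refl _, autLabel_refl _, (Iso.refl_trans δ).symm⟩
  have hne : lift δ 1 ≠ lift δ (Multiplicative.ofAdd 1) := fun h => by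
    have h2 : (1 : Multiplicative (ZMod 2)) = Multiplicative.ofAdd 1 :=
      congrArg (fun i : H.globF ≅ H.globF => i.hom.2) h
    exact absurd h2 (by decide)
  have hee' : S.baseGIso (lift δ 1) = S.baseGIso (lift δ (Multiplicative.ofAdd 1)) := by
    show F.mapIso (lift δ 1) = F.mapIso (lift δ (Multiplicative.ofAdd 1))
    rw [hlift, hlift]
  have he : S.baseGIso (lift δ 1) ∈ φ.nf.under.orbit := by
    show F.mapIso (lift δ 1) ∈ φ.nf.under.orbit
    rw [hlift]
    exact hmem
  exact ⟨S, H, S5Local.not_cor56ii_HTR_of_two_lifts φ _ _ hne hee' he⟩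

/-- **F-2046 is a schema**: the universal closure of `BaseThetaDatum.S5Local.Cor56ii_HTR` is FALSE (already over the base
model `trivialModel`); the content is the conditional closer `cor56ii_HTR_of_baseGIso_bijective` (Cor. 5.3 (i) rigidity).
[claim: Mochizuki2012, status: disputed] (IUTchI §5 Cor 5.6 (ii), kurims pp.153-154) -/
theorem not_forall_cor56ii_HTR :
    ¬ ∀ (𝔡 : BaseThetaDatum.{0}) (S : S5Local 𝔡) (H H' : S5Local.ThetaNFHodgeTheater S), S5Local.Cor56ii_HTR H H' :=
  fun h => by
    obtain ⟨S, H, hH⟩ := exists_not_cor56ii_HTR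
    exact hH (h trivialModel S H H)

/-- The row is a SCHEMA in the cell's sense: it FAILS at the stub above, and HOLDS between any two ΘNF-Hodge theaters over
the KIT-RULE witness `toyS5Local` (whose `baseGIso` is the identity: `cor56ii_HTR_of_baseGIso_bijective`).
[claim: Mochizuki2012, status: disputed] (IUTchI §5 Cor 5.6 (ii), kurims pp.153-154) -/
theorem cor56ii_HTR_schema :
    (∀ H H' : S5Local.ThetaNFHodgeTheater toyS5Local, S5Local.Cor56ii_HTR H H') ∧
      ∃ (S : S5Local trivialModel) (H : S5Local.ThetaNFHodgeTheater S), ¬ S5Local.Cor56ii_HTR H H :=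
  ⟨fun H H' => S5Local.cor56ii_HTR_of_baseGIso_bijective toyS5Local_baseGIso_bijective H H',
    exists_not_cor56ii_HTR⟩

end BaseThetaDatum

end Literature.IUT.HodgeTheaters
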